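import Summits.Ventures.HodgeRepro2.T5NormOneCharacters

/-!
# T5NormOneSquare — the square identity «χ|_{E¹} = ν_χ²» (Tier-5 support, seat p3)

Kernel witness behind ONE line already on the record: route/T5-route-3.md v0.31 §F.1 (the §G/N4.2
owner file), «NOT "χ_v∘det": on E¹ one has χ_v|_{E¹} = ν_{χ_v}² (for y = x/x̄ ∈ E¹:
χ(y) = χ(x)χ(x̄)⁻¹ = χ(x)², as χ(x̄) = χ(N x)χ(x)⁻¹ = χ(x)⁻¹), which differs from ν_{χ_v} in
general».

Setting (as in `T5NormOneCharacters`, file 31 of LEAN-ANNEX-p3): `L` a field with a ring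
involution `c` (E_v with its conjugation), `Lˣ` its unit group (E_v^×),
`normOne (unitsConj c)` = {y : y · c y = 1} the norm-one subgroup (E¹_v), `jHom` the map
a ↦ a / c a, and `φ : Lˣ →* M` a homomorphism trivial on the fixed units (a character χ of
E_v^× with χ|_{F_v^×} = 1).  File 31 factors φ = ν ∘ jHomNormOne (Hilbert 90).  Here:

* `map_conj_eq_inv` — φ(c a) = φ(a)⁻¹, because a · c a is fixed by the involution c;
* `map_jHom_eq_sq` — φ(a / c a) = φ(a)²;
* `restrict_normOne_eq_sq` — for the factor ν of file 31 and EVERY norm-one y: φ(y) = ν(y)²;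
* `exists_jHom_ne_self` / `exists_sq_ne_self` — the «in general» clause: on ℂ with c = complex
  conjugation and φ = jHom itself (trivial on the fixed units ℝ^×), ν is the inclusion of the
  circle and φ(i) = i² = −1 ≠ i = ν(i).

Pure group theory; no topology, no local field.  README §8(d): this file uses an L-value-free
non-vanishing device: NO.
-/

namespace Summit.Ventures.HodgeRepro2.T5NormOneSquare

open ShimuraData.B3Characters T5NormOneCharacters

section abstract

variable {A : Type*} [CommGroup A] {M : Type*} [Group M]

/-- A homomorphism `φ` trivial on the `c`-fixed points inverts under the involution `c`:
`φ (c a) = (φ a)⁻¹`, because `a * c a` is `c`-fixed. -/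
theorem map_conj_eq_inv (c : A ≃* A) (hc : ∀ x, c (c x) = x) (φ : A →* M)
    (hφ : ∀ a, c a = a → φ a = 1) (a : A) : φ (c a) = (φ a)⁻¹ := by
  have h : φ (a * c a) = 1 := hφ _ (by rw [map_mul, hc, mul_comm])
  rw [map_mul] at h
  exact eq_inv_of_mul_eq_one_right h

/-- `φ (a / c a) = (φ a) ^ 2` for `φ` trivial on the `c`-fixed points (the record's
«χ(y) = χ(x)χ(x̄)⁻¹ = χ(x)²» for y = x/x̄). -/
theorem map_jHom_eq_sq (c : A ≃* A) (hc : ∀ x, c (c x) = x) (φ : A →* M)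
    (hφ : ∀ a, c a = a → φ a = 1) (a : A) : φ (jHom c a) = (φ a) ^ 2 := by
  rw [jHom_apply, map_mul, map_inv, map_conj_eq_inv c hc φ hφ, inv_inv, sq]

/-- Every element of the range of `jHom c` (= the norm-one subgroup under Hilbert 90,
`T5NormOneCharacters.range_jHom_eq_normOne`) has `φ`-value a square: `φ y = (φ a) ^ 2` for
any `a` with `y = a / c a`. -/
theorem exists_map_eq_sq_of_mem_range (c : A ≃* A) (hc : ∀ x, c (c x) = x) (φ : A →* M)
    (hφ : ∀ a, c a = a → φ a = 1) {y : A} (hy : y ∈ (jHom c).range) :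
    ∃ a, y = jHom c a ∧ φ y = (φ a) ^ 2 := by
  obtain ⟨a, rfl⟩ := hy
  exact ⟨a, rfl, map_jHom_eq_sq c hc φ hφ a⟩

end abstract

section field

variable {L : Type*} [Field L] {M : Type*} [Group M]

/-- The fixed-unit hypothesis of file 31 (`c ↑a = ↑a → φ a = 1`) in the form needed on `Lˣ`
with the involution `unitsConj c`. -/
theorem map_eq_one_of_unitsConj_eq (c : L ≃+* L) (φ : Lˣ →* M)
    (hφ : ∀ a : Lˣ, c (a : L) = a → φ a = 1) (a : Lˣ) (ha : unitsConj c a = a) : φ a = 1 :=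
  hφ a (by rw [← coe_unitsConj, ha])

/-- The norm-one unit `jHomNormOne c hc a` is, as a unit, `jHom (unitsConj c) a` (= a / c a). -/
theorem coe_jHomNormOne_eq_jHom (c : L ≃+* L) (hc : ∀ x, c (c x) = x) (a : Lˣ) :
    ((jHomNormOne c hc a : normOne (unitsConj c)) : Lˣ) = jHom (unitsConj c) a := by
  apply Units.ext
  rw [coe_jHomNormOne, coe_jHom]

/-- THE SQUARE IDENTITY (§F.1): for a character `φ` of `Lˣ` trivial on the fixed units, the
factor `ν` of `T5NormOneCharacters.exists_factor_normOne` (φ a = ν (a / c a)) and EVERY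
norm-one unit `y` — `φ y = (ν y) ^ 2`: the restriction of χ to E¹ is the square of ν_χ. -/
theorem restrict_normOne_eq_sq (c : L ≃+* L) (hc : ∀ x, c (c x) = x) (hne : ∃ a, c a ≠ a)
    (φ : Lˣ →* M) (hφ : ∀ a : Lˣ, c (a : L) = a → φ a = 1)
    (ν : normOne (unitsConj c) →* M) (hν : ∀ a, φ a = ν (jHomNormOne c hc a))
    (y : normOne (unitsConj c)) : φ (y : Lˣ) = (ν y) ^ 2 := by
  obtain ⟨a, rfl⟩ := jHomNormOne_surjective c hc hne y
  rw [← hν, coe_jHomNormOne_eq_jHom]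
  exact map_jHom_eq_sq (unitsConj c) (unitsConj_unitsConj c hc) φ
    (map_eq_one_of_unitsConj_eq c φ hφ) a

/-- The same identity with the factor produced by file 31 (existence form): there is a `ν`
with `φ = ν ∘ jHomNormOne` and `φ y = (ν y) ^ 2` on the norm-one subgroup. -/
theorem exists_factor_and_sq (c : L ≃+* L) (hc : ∀ x, c (c x) = x) (hne : ∃ a, c a ≠ a)
    (φ : Lˣ →* M) (hφ : ∀ a : Lˣ, c (a : L) = a → φ a = 1) :
    ∃ ν : normOne (unitsConj c) →* M, (∀ a, φ a = ν (jHomNormOne c hc a)) ∧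
      ∀ y : normOne (unitsConj c), φ (y : Lˣ) = (ν y) ^ 2 := by
  obtain ⟨ν, hν⟩ := exists_factor_normOne c hc hne φ hφ
  exact ⟨ν, hν, restrict_normOne_eq_sq c hc hne φ hφ ν hν⟩

end field

section complex_example

/-- Complex conjugation as a ring involution of `ℂ` (Mathlib's `starRingAut`). -/
abbrev conjC : ℂ ≃+* ℂ := starRingAut

/-- `conjC` is an involution. -/
theorem conjC_conjC (x : ℂ) : conjC (conjC x) = x := by
  simp [conjC, starRingAut_apply]

/-- `conjC` is not the identity (it moves `i`). -/
theorem exists_conjC_ne : ∃ a : ℂ, conjC a ≠ a := by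
  refine ⟨Complex.I, ?_⟩
  show starRingAut Complex.I ≠ Complex.I
  rw [starRingAut_apply, Complex.star_def, Complex.conj_I]
  intro h
  have h2 := congrArg Complex.im h
  norm_num at h2

/-- The unit `i` of `ℂ`. -/
noncomputable abbrev unitI : ℂˣ := Units.mk0 Complex.I Complex.I_ne_zero

/-- `i` is a norm-one unit: `i · conj i = 1`. -/
theorem unitI_mem_normOne : unitI ∈ normOne (unitsConj conjC) := by
  rw [mem_normOne_iff]
  apply Units.ext
  simp [unitI, conjC, coe_unitsConj, starRingAut_apply, Complex.conj_I]

/-- `i` as an element of the norm-one subgroup (the circle). -/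
noncomputable abbrev circleI : normOne (unitsConj conjC) := ⟨unitI, unitI_mem_normOne⟩

/-- `jHom` (= x ↦ x / x̄) is trivial on the fixed units of `ℂˣ` (the real units), so it is a
character «χ» of the kind §F.1 considers; its factor ν is the inclusion of the circle. -/
theorem jHom_conjC_fixed (a : ℂˣ) (ha : conjC (a : ℂ) = a) : jHom (unitsConj conjC) a = 1 :=
  (mem_ker_jHom_iff _ _).mpr (Units.ext (by rw [coe_unitsConj]; exact ha))

/-- The inclusion of the circle factors `jHom` through `jHomNormOne`: ν = the subtype map. -/
theorem jHom_conjC_eq_subtype (a : ℂˣ) :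
    jHom (unitsConj conjC) a =
      (normOne (unitsConj conjC)).subtype (jHomNormOne conjC conjC_conjC a) := by
  rw [Subgroup.subtype_apply, coe_jHomNormOne_eq_jHom]

/-- THE «IN GENERAL» CLAUSE of §F.1: for χ = jHom on `ℂˣ` the value at the norm-one unit `i`
is `i / ī = i² = −1 ≠ i = ν(i)` — χ|_{E¹} ≠ ν_χ. -/
theorem jHom_unitI_ne_self : jHom (unitsConj conjC) unitI ≠ unitI := by
  intro h
  have h' := congrArg Units.val h
  rw [coe_jHom] at h'
  simp [unitI, conjC, starRingAut_apply, Complex.conj_I, Complex.ext_iff] at h'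

/-- The «in general» clause in the language of `restrict_normOne_eq_sq`: on the circle,
`(ν y) ^ 2 ≠ ν y` for `y = i` (ν = the inclusion), so the square identity cannot be read as
«χ|_{E¹} = ν_χ». -/
theorem exists_sq_ne_self :
    ∃ y : normOne (unitsConj conjC), ((y : ℂˣ)) ^ 2 ≠ (y : ℂˣ) := by
  refine ⟨circleI, ?_⟩
  have h := restrict_normOne_eq_sq conjC conjC_conjC exists_conjC_ne
    (jHom (unitsConj conjC)) jHom_conjC_fixed (normOne (unitsConj conjC)).subtype
    jHom_conjC_eq_subtype circleI
  rw [Subgroup.subtype_apply] at h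
  rw [← h]
  exact jHom_unitI_ne_self

/-- Restated: `jHom` and its factor ν (the inclusion) differ at `i`. -/
theorem exists_jHom_ne_self :
    ∃ y : normOne (unitsConj conjC), jHom (unitsConj conjC) (y : ℂˣ) ≠ (y : ℂˣ) :=
  ⟨circleI, jHom_unitI_ne_self⟩

end complex_example

end Summit.Ventures.HodgeRepro2.T5NormOneSquare
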